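import Literature.NumberTheory.EllipticCurves.Monsky1990.DescentLemmaHalving
import HarnessLib

/-!
# The `4`-torsion of `E : y² = x³ − x` under an automorphism moving `i` and fixing `√2`:
# `σ(P) − P ≠ (0, 0)` for every `P` with `4P = 0` — Tian 2014, Prop. 4.6 proof, the `E[4]` check, in the kernel

Cell `bsd-monsky` (prover-A seat, g13; `run/shared/lean/pub/bsd-monsky/`). HONEST FRAMING (README §1): pure algebra on
the curve `E : y² = x³ − x` (`congruentNumberCurve 1`) over an arbitrary field `H` of characteristic `0`; nothing is
asserted about BSD, nothing booked, no named fact. It is the finite check that Tian's proof of Prop. 4.6 makes on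
`E[4]` — the step that the cell's transplant of Monsky's descent (`CMPointSystemMonskyDescent.lean`, two odd primes)
did not need and that the one-prime base case `2p₀`, `p₀ ≡ 3 (mod 8)`, does (`CMPointSystemDescentPrimeBase.lean`).

## Source (verbatim, arXiv:1210.8231)

* §2 (p0008 L34–L40): "the set of torsion points with exact order `4` on `E` is the union of the following subsets:
  `(i, 1 − i) + E[2]`, `(1 + √2, 2 + √2) + E[2]`, and `(−1 − √2, i(2 + √2)) + E[2]`."
* Prop. 4.6 proof (p0023 L67–p0024 L5): "`E[4]/E[2]` is represented by `0, (i, 1 − i), (1 + √2, 2 + √2),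
  (−1 − √2, i(2 + √2))`. Note that `σ_{1+ϖ}` moves `i` but fixes `√2`. Thus `σ_{1+ϖ}` acts on any point `Q ∈ E[4]` via
  the complex conjugation. It follows immediately that `σ_{1+ϖ}(Q) − Q = 0` if `Q ≡ 0, (1 + √2, 2 + √2) mod E[2]` and
  `σ_{1+ϖ}(Q) − Q = (−1, 0)` otherwise. It is a contradiction."

## What is proved (kernel), and how

`map_sub_ne_ptZero_of_two_nsmul_two_nsmul_eq_zero`: for `σ ∈ Aut(H/ℚ)` with `σ(i) = −i` (`i² = −1`) and `σ(s) = s`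
for every `s` with `s² = 2`, and `P ∈ E(H)` with `4P = 0`: `σ(P) − P ≠ (0, 0)`. On coordinates, with the duplication
formula `x(2P) = ρ₀(P)² = ((x² + 1)/2y)²` (the tree's `Monsky1990.exists_two_nsmul_some_eq`) and `2P ∈ E[2] =
{O, (0,0), (1,0), (−1,0)}` (the tree's `Monsky1990.eq_of_two_nsmul_eq_zero`): `2P = O` — `P` rational, `σ(P) = P`; `2P = (0,0)` — `x² = −1`, `σ(x) = −x`,
`σ(y)² = −y²`, and the chord `σ(P) − P` has `x`-coordinate `−(y + σ(y))²/4 ≠ 0`; `2P = (1,0)` — `(x − 1)² = 2`,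
`y = ±(x − 1)x`, `σ(P) = P`; `2P = (−1,0)` — `(x + 1)² = 2`, `y = ±i(x + 1)x`, `σ(P) = −P`, `σ(P) − P = −2P = (−1,0)`.
No count of `E(H)[4]` is used (only that the listed equations have the listed solutions), so `H` need not contain
`i` or `√2`: the hypotheses are vacuous when it does not.

[cite: Tian2014, §2 (arXiv:1210.8231 p0008 L34–L40), Prop. 4.6 proof (p0023 L67–p0024 L5)] [cite: SilvermanAEC2009, III.2.3]
-/

noncomputable section

open scoped Classical

open WeierstrassCurve WeierstrassCurve.Affine Literature.NumberTheory.EllipticCurves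
open Literature.NumberTheory.EllipticCurves.Monsky1990 (baseChange_coeffs negY_eq sq_eq_of_nonsingular exists_two_nsmul_some_eq eq_of_two_nsmul_eq_zero map_sub_self_eq_zero_of_two_nsmul_eq_zero rho)

set_option autoImplicit false

namespace Literature.NumberTheory.EllipticCurves.Tian2014

/-! ## §1 The `4`-torsion of `E : y² = x³ − x` under an automorphism moving `i` and fixing `√2` -/

section FourTorsion

variable {H : Type} [Field H] [CharZero H]

/-- `−(−1, 0) = (−1, 0)` (a `2`-torsion point is its own negative). [cite: Tian2014, Thm. 2.8 (3) (p0011 L42–L44: the point (−1,0))] -/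
theorem neg_ptNegOne : -(ptNegOne : EPoint H) = ptNegOne := by
  rw [ptNegOne, Point.neg_some]
  simp only [negY_eq, neg_zero]

/-- **An automorphism `σ` of `H` moving `i` and fixing `√2` never shifts a `4`-torsion point of `E : y² = x³ − x`
by `(0, 0)`**: for every `P ∈ E(H)` with `4P = 0`, `σ(P) − P ≠ (0, 0)`. Tian's finite check on `E[4]/E[2] =
{0, (i, 1 − i), (1 + √2, 2 + √2), (−1 − √2, i(2 + √2))}` ("`σ_{1+ϖ}` acts on any point `Q ∈ E[4]` via the complex
conjugation … `σ_{1+ϖ}(Q) − Q = 0` if `Q ≡ 0, (1 + √2, 2 + √2) mod E[2]` and `σ_{1+ϖ}(Q) − Q = (−1, 0) otherwise`"),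
done on coordinates: `2P ∈ E[2]`; if `2P = (0,0)` then `x² = −1`, `y² = −2x`, `σ(x) = −x`, and `σ(P) − P` has
`x`-coordinate `−(y + σ(y))²/4 ≠ 0`; if `2P = (1,0)` then `(x − 1)² = 2`, `y = ±(x − 1)x`, so `σ(P) = P`; if
`2P = (−1,0)` then `(x + 1)² = 2`, `y = ±i(x + 1)x`, so `σ(P) = −P` and `σ(P) − P = −2P = (−1, 0)`; if `2P = 0`,
`P` is rational. [cite: Tian2014, Prop. 4.6 proof (arXiv:1210.8231 p0023 L67–p0024 L5); §2 (p0008 L34–L40: the 4-torsion of E)] -/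
theorem map_sub_ne_ptZero_of_two_nsmul_two_nsmul_eq_zero (σ : H ≃ₐ[ℚ] H) (im : H) (him : im ^ 2 = -1)
    (hσi : σ im = -im) (hσ2 : ∀ s : H, s ^ 2 = 2 → σ s = s) (P : EPoint H)
    (hP : (2 : ℕ) • ((2 : ℕ) • P) = 0) :
    Point.map (W' := congruentNumberCurve 1) σ.toAlgHom P - P ≠ ptZero := by
  obtain ⟨h1, h2, -, -, -⟩ := baseChange_coeffs (H := H)
  intro hcontra
  -- the four possibilities for `2P ∈ E[2]`
  rcases eq_of_two_nsmul_eq_zero _ hP with h2P | h2P | h2P | h2P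
  · -- `P ∈ E[2]` is rational: `σ(P) = P`
    rw [map_sub_self_eq_zero_of_two_nsmul_eq_zero σ P h2P] at hcontra
    exact Point.some_ne_zero _ hcontra.symm
  all_goals
    -- `P` is affine with `y ≠ 0`, and `x(2P) = ρ₀(P)²` with `ρ₀(P)·2y = x² + 1`
    rcases P with _ | ⟨x, y, h⟩
    · rw [← Point.zero_def, smul_zero] at h2P; exact Point.some_ne_zero _ h2P.symm
    have heq : y ^ 2 = x ^ 3 - x := sq_eq_of_nonsingular h
    have hy : y ≠ 0 := by
      intro hy0
      rw [two_nsmul, Point.add_self_of_Y_eq (by rw [negY_eq, hy0, neg_zero])] at h2P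
      exact Point.some_ne_zero _ h2P.symm
    obtain ⟨y₂, h₂, h2eq⟩ := exists_two_nsmul_some_eq h hy
    have hrho : rho 0 x y * (2 * y) = x ^ 2 + 1 := by
      unfold rho
      rw [div_mul_cancel₀ _ (mul_ne_zero two_ne_zero hy)]
      ring
    have hx₂ : rho 0 x y ^ 2 * (4 * y ^ 2) = (x ^ 2 + 1) ^ 2 := by rw [← hrho]; ring
    rw [h2eq] at h2P
    have hX := (Point.some.inj h2P).1
  · -- `2P = (0,0)`: `x² = −1`, `σ(x) = −x`, and the chord from `P` to `σ(P)` is not vertical through `(0,0)`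
    have hx2 : x ^ 2 = -1 := by
      rw [hX, zero_mul] at hx₂
      have h0 : (x ^ 2 + 1) ^ 2 = 0 := hx₂.symm
      have := pow_eq_zero_iff (n := 2) (by norm_num) |>.mp h0
      linear_combination this
    have hσx' : σ x = -x := by
      have hfac : (x - im) * (x + im) = 0 := by linear_combination hx2 - him
      rcases mul_eq_zero.mp hfac with e | e
      · have : x = im := by linear_combination e
        rw [this, hσi]
      · have : x = -im := by linear_combination e
        rw [this, map_neg, hσi, neg_neg]
    have hx0 : x ≠ 0 := by intro e; rw [e] at hx2; norm_num at hx2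
    have hxne₀ : σ x ≠ x := by rw [hσx']; intro e; apply hx0; linear_combination -e / 2
    have hxne : σ.toAlgHom x ≠ x := hxne₀
    have hσy2 : (σ y) ^ 2 = -(y ^ 2) := by
      rw [← map_pow, heq, map_sub, map_pow, hσx']
      ring
    rw [Point.map_some, sub_eq_add_neg, Point.neg_some, Point.add_of_X_ne hxne, ptZero] at hcontra
    have hX' := (Point.some.inj hcontra).1
    simp only [AlgEquiv.coe_toAlgHom] at hX'
    rw [addX, slope_of_X_ne hxne₀, h1, h2, negY_eq, hσx'] at hX'
    have hdiv : (σ y - -y) / (-x - x) = (σ y + y) / (-(2 * x)) := by ring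
    rw [hdiv, div_pow, neg_pow_two] at hX'
    have h4x : (2 * x) ^ 2 = -4 := by linear_combination 4 * hx2
    rw [h4x] at hX'
    have hsum : (σ y + y) ^ 2 = 0 := by
      have h0 : (σ y + y) ^ 2 / (-4) = 0 := by linear_combination hX'
      rcases div_eq_zero_iff.mp h0 with e | e
      · exact e
      · norm_num at e
    have hsum' : σ y = -y := by
      have := pow_eq_zero_iff (n := 2) (by norm_num) |>.mp hsum
      linear_combination this
    rw [hsum', neg_pow_two] at hσy2
    have h0 : y ^ 2 = 0 := by linear_combination hσy2 / 2
    exact hy (pow_eq_zero_iff (n := 2) (by norm_num) |>.mp h0)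
  · -- `2P = (1,0)`: `(x − 1)² = 2`, `y = ±(x − 1)·x`, so `σ(P) = P`
    have hs : (x - 1) ^ 2 = 2 := by
      rw [hX, one_mul] at hx₂
      have key : (x ^ 2 - 2 * x - 1) ^ 2 = 0 := by linear_combination -hx₂ + 4 * heq
      have := pow_eq_zero_iff (n := 2) (by norm_num) |>.mp key
      linear_combination this
    have hσs : σ (x - 1) = x - 1 := hσ2 _ hs
    have hσx' : σ x = x := by
      have := hσs; rw [map_sub, map_one] at this; linear_combination this
    have hy' : y = (x - 1) * x ∨ y = -((x - 1) * x) := by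
      have hfac : (y - (x - 1) * x) * (y + (x - 1) * x) = 0 := by
        linear_combination heq + (x - x ^ 2) * hs
      rcases mul_eq_zero.mp hfac with e | e
      · left; linear_combination e
      · right; linear_combination e
    have hσy' : σ y = y := by
      rcases hy' with rfl | rfl
      · rw [map_mul, hσs, hσx']
      · rw [map_neg, map_mul, hσs, hσx']
    have hmap : Point.map (W' := congruentNumberCurve 1) σ.toAlgHom (Point.some x y h) = Point.some x y h := by
      rw [Point.map_some]
      simp only [Point.some.injEq, AlgEquiv.coe_toAlgHom]
      exact ⟨hσx', hσy'⟩
    rw [hmap, sub_self] at hcontra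
    exact Point.some_ne_zero _ hcontra.symm
  · -- `2P = (−1,0)`: `(x + 1)² = 2`, `y = ±i(x + 1)x`, so `σ(P) = −P` and `σ(P) − P = −2P = (−1,0)`
    have hs : (x + 1) ^ 2 = 2 := by
      rw [hX, neg_one_mul] at hx₂
      have key : (x ^ 2 + 2 * x - 1) ^ 2 = 0 := by linear_combination -hx₂ - 4 * heq
      have := pow_eq_zero_iff (n := 2) (by norm_num) |>.mp key
      linear_combination this
    have hσs : σ (x + 1) = x + 1 := hσ2 _ hs
    have hσx' : σ x = x := by
      have := hσs; rw [map_add, map_one] at this; linear_combination this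
    have hy' : y = im * ((x + 1) * x) ∨ y = -(im * ((x + 1) * x)) := by
      have hfac : (y - im * ((x + 1) * x)) * (y + im * ((x + 1) * x)) = 0 := by
        linear_combination heq + (x ^ 2 + x) * hs - (x + 1) ^ 2 * x ^ 2 * him
      rcases mul_eq_zero.mp hfac with e | e
      · left; linear_combination e
      · right; linear_combination e
    have hσy' : σ y = -y := by
      rcases hy' with rfl | rfl
      · rw [map_mul, map_mul, hσs, hσx', hσi]; ring
      · rw [map_neg, map_mul, map_mul, hσs, hσx', hσi]; ring
    have hmap : Point.map (W' := congruentNumberCurve 1) σ.toAlgHom (Point.some x y h) = -Point.some x y h := by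
      rw [Point.map_some, Point.neg_some]
      simp only [Point.some.injEq, AlgEquiv.coe_toAlgHom, negY_eq]
      exact ⟨hσx', hσy'⟩
    rw [hmap, sub_eq_add_neg, ← neg_add, ← two_nsmul, h2eq, h2P, neg_ptNegOne, ptNegOne, ptZero] at hcontra
    have := (Point.some.inj hcontra).1
    norm_num at this

end FourTorsion

end Literature.NumberTheory.EllipticCurves.Tian2014

end
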